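import Summits.KontsevichZagierPeriods.KontsevichZagierPeriods.Theorems.RootDecompQuadraticDescentPair18HomotopyP06

/-! # `RootDecompQuadraticDescentPair18HomotopyP07` — part 7/31 of the mechanical ≤400-line split of `Pair18Homotopy_v14_noguard.lean` (sha256 72e9c8442b4af820…)
Source: decomp-kz lens-6 g9 `Pair18Homotopy.lean` v14 (HOME/decomp-kz-lens-6/g9/, sha256 3dda3232…; critic g4-48/g4-53/g4-56/g5 CLEARED; census pair #18 of crux stmt-KontsevichZagierPeriods-28994: homotopy cells, duplications, inversions, Euler–Landen, arc/angle regions; terminal `pair18_g8strips_of_grid : hEuler → hGrid → hAng4 → (g8 form of #18)`); `#guard_msgs … #print axioms` pins removed for landing.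
Split by census-1 g9 `gen/splitlean.py`: scopes re-opened with their `open`/`variable`/`set_option` context; mathematics and declaration order unchanged. -/

set_option linter.unusedSimpArgs false
noncomputable section
open _root_.Set MvPolynomial
namespace Summit.KontsevichZagierPeriods.RootDecompQuadraticDescent.Pair18Homotopy
open Literature.NumberTheory.Transcendental
open Literature.NumberTheory.Transcendental.KZ (RFun cube)
open Summit.KontsevichZagierPeriods.RootDecompQuadraticDescent.DarkPairs (rel_reflect_rep rel_double)
/-- Auxiliary step `vec2_1` (§2b): vec2 1. [bookkeeping] -/
private theorem vec2_1 (a b : ℝ) : (![a, b] : Fin 2 → ℝ) 1 = b := rfl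

/-- Auxiliary step `vec2_0` (§2b): vec2 0. [bookkeeping] -/
private theorem vec2_0 (a b : ℝ) : (![a, b] : Fin 2 → ℝ) 0 = a := rfl

/-- Dyadic subdivision of the square along the coordinate `i` (rules 1+2).
[cite: KontsevichZagier2001, §1.2 rules 1, 2] -/
private theorem rel_subdiv (i : Fin 2) (T T₁ T₂ : RFun 2)
    (h₁ : ∀ x ∈ cube 2, T₁.fn x = (1 / 2 : ℝ) * T.fn (Function.update x i (x i / 2)))
    (h₂ : ∀ x ∈ cube 2, T₂.fn x = (1 / 2 : ℝ) * T.fn (Function.update x i ((1 + x i) / 2))) :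
    KZ.of T.rep - KZ.of T₁.rep - KZ.of T₂.rep ∈ KZ.relations :=
  KZ.cubicalSubdivGens_subset_relations ⟨2, T.rep, T₁.rep, T₂.rep, i, rfl, T.analyticOnNhd_fn, rfl,
    T₁.analyticOnNhd_fn, rfl, T₂.analyticOnNhd_fn, h₁, h₂, rfl⟩

/-- Auxiliary step `cube2` (§0): cube2. [bookkeeping] -/
private theorem cube2 {x : Fin 2 → ℝ} (hx : x ∈ KZ.cube 2) : (0 ≤ x 0 ∧ x 0 ≤ 1) ∧ (0 ≤ x 1 ∧ x 1 ≤ 1) := ⟨hx 0, hx 1⟩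

section Inv

/-- Auxiliary step `Shp_moeb`: Shp moeb. [bookkeeping] -/
theorem Shp_moeb : KZ.of Shp.rep - KZ.of GpUr.rep ∈ KZ.relations :=
  rel_moeb Shp GpUr fun z hz => by
    have h0 : (0 : ℝ) ≤ z 0 := (hz 0).1
    have hne : (1 : ℝ) + z 0 ≠ 0 := by positivity
    have hA := (ShpDen_pos hz).ne'
    simp only [RFun.fn, map_add, map_sub, map_mul, map_pow, map_neg, aeval_C, aeval_X, map_one, map_ofNat,
      eq_ratCast, Rat.cast_one, Rat.cast_ofNat, Rat.cast_div, Rat.cast_neg, Rat.cast_zero, Shp, GpUr, ShpDen, GpUrDen, vec2_0, vec2_1] at hA ⊢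
    have hB : 2 * z 0 / (1 + z 0) * (2 * z 0 / (1 + z 0)) +
        z 1 * (2 - 2 * z 0 / (1 + z 0)) * (2 * z 0 / (1 + z 0)) +
        2 * (2 - 2 * z 0 / (1 + z 0)) * (2 - 2 * z 0 / (1 + z 0)) =
        4 * (2 + z 0 * z 0 + z 1 * z 0) / (1 + z 0) ^ 2 := by
      field_simp
      ring
    rw [hB]
    field_simp
    ring

/-- **INVERSION, minus side:** `[Sm] + [Shm] − [Gm] ∈ KZ.relations`
(`∫₀¹ + ∫₁^∞ = ∫₀^∞` for `½dx/(1 − sx + 2x²)`, realised by subdivision + Möbius + reflection). -/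
theorem invM : KZ.of Sm.rep + KZ.of Shm.rep - KZ.of Gm.rep ∈ KZ.relations := by
  have e : KZ.of Sm.rep + KZ.of Shm.rep - KZ.of Gm.rep =
      (KZ.of Sm.rep - KZ.of GmL.rep) + (KZ.of Shm.rep - KZ.of GmUr.rep)
      + (KZ.of GmUr.rep - KZ.of GmU.rep) - (KZ.of Gm.rep - KZ.of GmL.rep - KZ.of GmU.rep) := by abel
  rw [e]
  exact sub_mem (add_mem (add_mem Sm_moeb Shm_moeb) GmUr_rel) Gm_subdiv

/-- **INVERSION, plus side:** `[Sp] + [Shp] − [Gp] ∈ KZ.relations`. -/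
theorem invP : KZ.of Sp.rep + KZ.of Shp.rep - KZ.of Gp.rep ∈ KZ.relations := by
  have e : KZ.of Sp.rep + KZ.of Shp.rep - KZ.of Gp.rep =
      (KZ.of Sp.rep - KZ.of GpL.rep) + (KZ.of Shp.rep - KZ.of GpUr.rep)
      + (KZ.of GpUr.rep - KZ.of GpU.rep) - (KZ.of Gp.rep - KZ.of GpL.rep - KZ.of GpU.rep) := by abel
  rw [e]
  exact sub_mem (add_mem (add_mem Sp_moeb Shp_moeb) GpUr_rel) Gp_subdiv

end Inv

/-! ## §3 The reduction of census pair #18 (strip form (C′)) -/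

/-- **Pair #18, strip form (C′), from two inversion identities and ONE elementary identity.**

Hypotheses (all three are memberships in `KZ.relations` between the strips defined in §1):
* `hInvM : [Sm] + [Shm] ≡ [Gm]`, `hInvP : [Sp] + [Shp] ≡ [Gp]` — the INVERSION `x ↦ 1/x` on the two
  halves `s ≷ ½` of `[Gm]`, `[Gp]` (two Möbius fibre maps `x = s/(1−s)` each; rule 2; NODE §9.4);
* `hElem` — the identity
  `4[Gm] + 2[Gp] + 2·(2[Sp] + 2[Sm] + [M2]) + 10[Crit1] − [Crit2] − 21[U2r] − ([E0] + [Ax1] − [U1]) ≡ 0`,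
  every bracket of which has an ELEMENTARY value (`[Gm] = ½((π−θ)² − π²/4)`, `[Gp] = ½(π²/4 − θ²)`,
  `2[Sp]+2[Sm]+[M2] = Θ(B₂) − Θ(P₀)` = reflection junk `= ½log²2 + 2π² − 6πθ + 2θ²`,
  `[Crit1] = θ² − ¾log²2`, `[Crit2] = (2π−4θ)² − θ² + (15/4)log²2`, `[U2r] = Li₂(½) = π²/12 − ½log²2`,
  `[E0]+[Ax1]−[U1] = ¼log²2`; `θ = arctan √7`; the total has coefficients `0,0,0,0` on
  `log²2, π², πθ, θ²` and is numerically `1.8e−15`; `math/strips18.py`).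
Everything else — nine homotopy cells (§2) and four duplications (§2b) — is proved above.  Integer
certificate: `(C′) = H1 + 2·C2 − 11·C3 + 10·C4 + C5b + C5a + 2·C6 + 2·C7 + 2·C8 + 11·Sm2r_rel + 11·Sm2_rel`
`− 10·C4top_rel + C5aBot_rel + 2·C8Bot_rel + 4·InvM + 2·InvP + 2·d1 + d2 + p4 + 2·p2 + Elem`. -/
theorem pair18_strips_of_elementary
    (hInvM : KZ.of Sm.rep + KZ.of Shm.rep - KZ.of Gm.rep ∈ KZ.relations)
    (hInvP : KZ.of Sp.rep + KZ.of Shp.rep - KZ.of Gp.rep ∈ KZ.relations)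
    (hElem : 4 • KZ.of Gm.rep + 2 • KZ.of Gp.rep + 2 • (2 • KZ.of Sp.rep + 2 • KZ.of Sm.rep + KZ.of M2.rep)
      + 10 • KZ.of Crit1.rep - KZ.of Crit2.rep - 21 • KZ.of U2r.rep - (KZ.of E0.rep + KZ.of Ax1.rep - KZ.of U1.rep) ∈ KZ.relations) :
    KZ.of U1.rep - KZ.of U2r.rep + KZ.of SL.rep - 2 • (KZ.of Sp.rep + KZ.of Sm.rep) + 2 • (KZ.of Shp.rep + KZ.of Shm.rep) ∈ KZ.relations := by
  have e : KZ.of U1.rep - KZ.of U2r.rep + KZ.of SL.rep - 2 • (KZ.of Sp.rep + KZ.of Sm.rep) + 2 • (KZ.of Shp.rep + KZ.of Shm.rep) =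
      (1 : ℤ) • (KZ.of SL.rep + KZ.of E0.rep - 2 • KZ.of Shm.rep)
      + (2 : ℤ) • (-KZ.of Nm.rep + 2 • KZ.of Sm.rep - KZ.of M2.rep + KZ.of Ax2.rep)
      + (-11 : ℤ) • (KZ.of Sm2r.rep - KZ.of SegKO.rep - KZ.of Ax1.rep + KZ.of Crit1.rep)
      + (10 : ℤ) • (KZ.of C4top.rep - KZ.of SegKO.rep)
      + (1 : ℤ) • (-KZ.of SegKO.rep - KZ.of SegOPa.rep + KZ.of Crit1.rep)
      + (1 : ℤ) • (KZ.of Crit2.rep - KZ.of C5aBot.rep - KZ.of M3.rep + KZ.of SegOPa.rep)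
      + (2 : ℤ) • (-KZ.of Ax1.rep - KZ.of Ax2.rep + KZ.of Ax04.rep)
      + (2 : ℤ) • (KZ.of Np.rep - KZ.of N4.rep - KZ.of M1.rep)
      + (2 : ℤ) • (KZ.of N4.rep - KZ.of C8Bot.rep + KZ.of Ax04.rep)
      + (11 : ℤ) • (KZ.of Sm2r.rep - KZ.of Sm2.rep)
      + (11 : ℤ) • (KZ.of Sm2.rep - 2 • KZ.of Sm.rep)
      + (-10 : ℤ) • (KZ.of C4top.rep - 2 • KZ.of U2r.rep)
      + (1 : ℤ) • (KZ.of C5aBot.rep - KZ.of Par4.rep)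
      + (2 : ℤ) • (KZ.of C8Bot.rep - KZ.of Par2.rep)
      + (4 : ℤ) • (KZ.of Sm.rep + KZ.of Shm.rep - KZ.of Gm.rep)
      + (2 : ℤ) • (KZ.of Sp.rep + KZ.of Shp.rep - KZ.of Gp.rep)
      + (2 : ℤ) • (KZ.of M1.rep - 4 • KZ.of Sp.rep + 4 • KZ.of Sm.rep)
      + (1 : ℤ) • (KZ.of M3.rep - 2 • KZ.of Np.rep + 2 • KZ.of Nm.rep)
      + (1 : ℤ) • (KZ.of Par4.rep - 4 • KZ.of Ax04.rep)
      + (2 : ℤ) • (KZ.of Par2.rep - 4 • KZ.of Ax1.rep)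
      + (1 : ℤ) • (4 • KZ.of Gm.rep + 2 • KZ.of Gp.rep + 2 • (2 • KZ.of Sp.rep + 2 • KZ.of Sm.rep + KZ.of M2.rep)
      + 10 • KZ.of Crit1.rep - KZ.of Crit2.rep - 21 • KZ.of U2r.rep - (KZ.of E0.rep + KZ.of Ax1.rep - KZ.of U1.rep)) := by
    abel
  rw [e]
  exact (add_mem (add_mem (add_mem (add_mem (add_mem (add_mem (add_mem (add_mem (add_mem (add_mem (add_mem (add_mem (add_mem (add_mem (add_mem (add_mem (add_mem (add_mem (add_mem (add_mem (zsmul_mem CellH1.rel (1 : ℤ))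
    (zsmul_mem CellC2.rel (2 : ℤ)))
    (zsmul_mem CellC3.rel (-11 : ℤ)))
    (zsmul_mem CellC4.rel (10 : ℤ)))
    (zsmul_mem CellC5b.rel (1 : ℤ)))
    (zsmul_mem CellC5a.rel (1 : ℤ)))
    (zsmul_mem CellC6.rel (2 : ℤ)))
    (zsmul_mem CellC7.rel (2 : ℤ)))
    (zsmul_mem CellC8.rel (2 : ℤ)))
    (zsmul_mem Sm2r_rel (11 : ℤ)))
    (zsmul_mem Sm2_rel (11 : ℤ)))
    (zsmul_mem C4top_rel (-10 : ℤ)))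
    (zsmul_mem C5aBot_rel (1 : ℤ)))
    (zsmul_mem C8Bot_rel (2 : ℤ)))
    (zsmul_mem hInvM (4 : ℤ)))
    (zsmul_mem hInvP (2 : ℤ)))
    (zsmul_mem d1 (2 : ℤ)))
    (zsmul_mem d2 (1 : ℤ)))
    (zsmul_mem p4 (1 : ℤ)))
    (zsmul_mem p2 (2 : ℤ)))
    (zsmul_mem hElem (1 : ℤ)))

/-- **Pair #18 (strip form (C′)) from ONE elementary identity.**  The inversions are now theorems
(`invM`, `invP`, §2c); the only remaining input is `hElem`, a `ℤ`-combination of boxes each of which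
is an elementary period (values listed at `pair18_strips_of_elementary`). -/
theorem pair18_strips_of_elem
    (hElem : 4 • KZ.of Gm.rep + 2 • KZ.of Gp.rep + 2 • (2 • KZ.of Sp.rep + 2 • KZ.of Sm.rep + KZ.of M2.rep)
      + 10 • KZ.of Crit1.rep - KZ.of Crit2.rep - 21 • KZ.of U2r.rep - (KZ.of E0.rep + KZ.of Ax1.rep - KZ.of U1.rep) ∈ KZ.relations) :
    KZ.of U1.rep - KZ.of U2r.rep + KZ.of SL.rep - 2 • (KZ.of Sp.rep + KZ.of Sm.rep) + 2 • (KZ.of Shp.rep + KZ.of Shm.rep) ∈ KZ.relations :=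
  pair18_strips_of_elementary invM invP hElem

/-! ## §4 Interface with the g8 strip form of `pair18_iff_strips`

g8 (`decomp-kz-lens-6/g8/Pair18Reduction.lean`, thm `pair18_iff_strips`) proved
`[A18] − 2•[B18] ∈ KZ.relations ↔ [U1] − [U2r] + [SL] − 2•[K12c] + 2•[Kh] ∈ KZ.relations`
with `U1, U2r, SL` as in §1 (verbatim) and `K12c = [□², 1/(1+2x²+x(2y−1))]`, `Kh = [□², 1/(2+x²+x(2y−1))]`
(verbatim below).  Subdividing `y` at `½` turns `[K12c]` into `[Sp] + [Sm]` and `[Kh]` into `[Shp] + [Shm]`. -/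

section G8

/-- Auxiliary definition `K12cDen` (§4): K12c Den. [bookkeeping] -/
def K12cDen : MvPolynomial (Fin 2) ℚ := C 1 + C 2 * X 0 * X 0 + X 0 * (C 2 * X 1 - C 1)
/-- Auxiliary step `K12cDen_pos` (§4): K12c Den pos. [bookkeeping] -/
theorem K12cDen_pos {x : Fin 2 → ℝ} (hx : x ∈ cube 2) : 0 < aeval x K12cDen := by
  obtain ⟨h0, h1⟩ := cube2 hx
  simp only [K12cDen, map_add, map_sub, map_mul, map_pow, map_neg, aeval_C, aeval_X, map_one, map_ofNat,
      eq_ratCast, Rat.cast_one, Rat.cast_ofNat, Rat.cast_div, Rat.cast_neg, Rat.cast_zero]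
  nlinarith [sq_nonneg (x 0 - 1 / 4), mul_nonneg h1.1 h0.1, mul_nonneg h0.1 h0.1]
/-- g8's `K12c` (verbatim). -/
def K12c : RFun 2 := ⟨C 1, K12cDen, fun _ hx => (K12cDen_pos hx).ne'⟩
/-- Auxiliary definition `KhDen` (§4): Kh Den. [bookkeeping] -/
def KhDen : MvPolynomial (Fin 2) ℚ := C 2 + X 0 * X 0 + X 0 * (C 2 * X 1 - C 1)
/-- Auxiliary step `KhDen_pos` (§4): Kh Den pos. [bookkeeping] -/
theorem KhDen_pos {x : Fin 2 → ℝ} (hx : x ∈ cube 2) : 0 < aeval x KhDen := by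
  obtain ⟨h0, h1⟩ := cube2 hx
  simp only [KhDen, map_add, map_sub, map_mul, map_pow, map_neg, aeval_C, aeval_X, map_one, map_ofNat,
      eq_ratCast, Rat.cast_one, Rat.cast_ofNat, Rat.cast_div, Rat.cast_neg, Rat.cast_zero]
  nlinarith [sq_nonneg (x 0 - 1 / 2), mul_nonneg h1.1 h0.1, mul_nonneg h0.1 h0.1]
/-- g8's `Kh` (verbatim). -/
def Kh : RFun 2 := ⟨C 1, KhDen, fun _ hx => (KhDen_pos hx).ne'⟩

/-- Auxiliary definition `ShmrDen` (§4): Shmr Den. [bookkeeping] -/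
def ShmrDen : MvPolynomial (Fin 2) ℚ := C 2 + X 0 * X 0 - (C 1 - X 1) * X 0
/-- Auxiliary step `ShmrDen_pos` (§4): Shmr Den pos. [bookkeeping] -/
theorem ShmrDen_pos {x : Fin 2 → ℝ} (hx : x ∈ cube 2) : 0 < aeval x ShmrDen := by
  obtain ⟨h0, h1⟩ := cube2 hx
  simp only [ShmrDen, map_add, map_sub, map_mul, map_pow, map_neg, aeval_C, aeval_X, map_one, map_ofNat,
      eq_ratCast, Rat.cast_one, Rat.cast_ofNat, Rat.cast_div, Rat.cast_neg, Rat.cast_zero]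
  nlinarith [sq_nonneg (x 0 - 1 / 2), mul_nonneg h1.1 h0.1, mul_nonneg h0.1 h0.1]
/-- Auxiliary definition `Shmr` (§4): Shmr. [bookkeeping] -/
def Shmr : RFun 2 := ⟨C (1 / 2), ShmrDen, fun _ hx => (ShmrDen_pos hx).ne'⟩

/-- Auxiliary step `mem_cube_update_one` (§4): mem cube update one. [bookkeeping] -/
theorem mem_cube_update_one {x : Fin 2 → ℝ} (hx : x ∈ cube 2) {a : ℝ} (ha : 0 ≤ a ∧ a ≤ 1) :
    Function.update x 1 a ∈ cube 2 := fun i => by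
  fin_cases i
  · simpa using hx 0
  · simpa using ha

/-- `[K12c] ≡ [Smr] + [Sp]` (subdivision of `y` at `½`). -/
theorem K12c_split : KZ.of K12c.rep - KZ.of Smr.rep - KZ.of Sp.rep ∈ KZ.relations := by
  refine rel_subdiv 1 K12c Smr Sp (fun x hx => ?_) (fun x hx => ?_)
  · have hA := (SmrDen_pos hx).ne'
    have hB := (K12cDen_pos (mem_cube_update_one hx (a := x 1 / 2)
      ⟨div_nonneg (hx 1).1 zero_le_two, by linarith [(hx 1).2]⟩)).ne'
    simp only [RFun.fn, map_add, map_sub, map_mul, map_pow, map_neg, aeval_C, aeval_X, map_one, map_ofNat,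
      eq_ratCast, Rat.cast_one, Rat.cast_ofNat, Rat.cast_div, Rat.cast_neg, Rat.cast_zero, K12c, Smr, K12cDen, SmrDen, Function.update_self,
      DarkPairs.update_one_apply_zero] at hA hB ⊢
    field_simp
    ring
  · have hA := (SpDen_pos hx).ne'
    have hB := (K12cDen_pos (mem_cube_update_one hx (a := (1 + x 1) / 2)
      ⟨div_nonneg (by linarith [(hx 1).1]) zero_le_two, by linarith [(hx 1).2]⟩)).ne'
    simp only [RFun.fn, map_add, map_sub, map_mul, map_pow, map_neg, aeval_C, aeval_X, map_one, map_ofNat,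
      eq_ratCast, Rat.cast_one, Rat.cast_ofNat, Rat.cast_div, Rat.cast_neg, Rat.cast_zero, K12c, Sp, K12cDen, SpDen, Function.update_self,
      DarkPairs.update_one_apply_zero] at hA hB ⊢
    field_simp
    ring

/-- `[Kh] ≡ [Shmr] + [Shp]`. -/
theorem Kh_split : KZ.of Kh.rep - KZ.of Shmr.rep - KZ.of Shp.rep ∈ KZ.relations := by
  refine rel_subdiv 1 Kh Shmr Shp (fun x hx => ?_) (fun x hx => ?_)
  · have hA := (ShmrDen_pos hx).ne'
    have hB := (KhDen_pos (mem_cube_update_one hx (a := x 1 / 2)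
      ⟨div_nonneg (hx 1).1 zero_le_two, by linarith [(hx 1).2]⟩)).ne'
    simp only [RFun.fn, map_add, map_sub, map_mul, map_pow, map_neg, aeval_C, aeval_X, map_one, map_ofNat,
      eq_ratCast, Rat.cast_one, Rat.cast_ofNat, Rat.cast_div, Rat.cast_neg, Rat.cast_zero, Kh, Shmr, KhDen, ShmrDen, Function.update_self,
      DarkPairs.update_one_apply_zero] at hA hB ⊢
    field_simp
    ring
  · have hA := (ShpDen_pos hx).ne'
    have hB := (KhDen_pos (mem_cube_update_one hx (a := (1 + x 1) / 2)
      ⟨div_nonneg (by linarith [(hx 1).1]) zero_le_two, by linarith [(hx 1).2]⟩)).ne'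
    simp only [RFun.fn, map_add, map_sub, map_mul, map_pow, map_neg, aeval_C, aeval_X, map_one, map_ofNat,
      eq_ratCast, Rat.cast_one, Rat.cast_ofNat, Rat.cast_div, Rat.cast_neg, Rat.cast_zero, Kh, Shp, KhDen, ShpDen, Function.update_self,
      DarkPairs.update_one_apply_zero] at hA hB ⊢
    field_simp
    ring

/-- `[Smr] ≡ [Sm]` (reflection `y ↦ 1 − y`). -/
theorem Smr_rel : KZ.of Smr.rep - KZ.of Sm.rep ∈ KZ.relations :=
  rel_reflect 1 Sm Smr fun x _ => by
    simp only [RFun.fn, map_add, map_sub, map_mul, map_pow, map_neg, aeval_C, aeval_X, map_one, map_ofNat,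
      eq_ratCast, Rat.cast_one, Rat.cast_ofNat, Rat.cast_div, Rat.cast_neg, Rat.cast_zero, Sm, Smr, SmDen, SmrDen, Function.update_self,
      DarkPairs.update_one_apply_zero]

/-- Auxiliary step `Shmr_rel` (§4): Shmr rel. [bookkeeping] -/
theorem Shmr_rel : KZ.of Shmr.rep - KZ.of Shm.rep ∈ KZ.relations :=
  rel_reflect 1 Shm Shmr fun x _ => by
    simp only [RFun.fn, map_add, map_sub, map_mul, map_pow, map_neg, aeval_C, aeval_X, map_one, map_ofNat,
      eq_ratCast, Rat.cast_one, Rat.cast_ofNat, Rat.cast_div, Rat.cast_neg, Rat.cast_zero, Shm, Shmr, ShmDen, ShmrDen, Function.update_self,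
      DarkPairs.update_one_apply_zero]

/-- **Pair #18 in g8's strip form, from ONE elementary identity:**
`hElem → [U1] − [U2r] + [SL] − 2•[K12c] + 2•[Kh] ∈ KZ.relations`; composed with g8's
`pair18_iff_strips.mpr` this is `hElem → [A18] − 2•[B18] ∈ KZ.relations` (census row #18). -/
theorem pair18_g8strips_of_elem
    (hElem : 4 • KZ.of Gm.rep + 2 • KZ.of Gp.rep + 2 • (2 • KZ.of Sp.rep + 2 • KZ.of Sm.rep + KZ.of M2.rep)
      + 10 • KZ.of Crit1.rep - KZ.of Crit2.rep - 21 • KZ.of U2r.rep - (KZ.of E0.rep + KZ.of Ax1.rep - KZ.of U1.rep) ∈ KZ.relations) :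
    KZ.of U1.rep - KZ.of U2r.rep + KZ.of SL.rep - 2 • KZ.of K12c.rep + 2 • KZ.of Kh.rep ∈ KZ.relations := by
  have e : KZ.of U1.rep - KZ.of U2r.rep + KZ.of SL.rep - 2 • KZ.of K12c.rep + 2 • KZ.of Kh.rep =
      (KZ.of U1.rep - KZ.of U2r.rep + KZ.of SL.rep - 2 • (KZ.of Sp.rep + KZ.of Sm.rep) + 2 • (KZ.of Shp.rep + KZ.of Shm.rep))
      - 2 • (KZ.of K12c.rep - KZ.of Smr.rep - KZ.of Sp.rep) - 2 • (KZ.of Smr.rep - KZ.of Sm.rep)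
      + 2 • (KZ.of Kh.rep - KZ.of Shmr.rep - KZ.of Shp.rep) + 2 • (KZ.of Shmr.rep - KZ.of Shm.rep) := by abel
  rw [e]
  exact add_mem (add_mem (sub_mem (sub_mem (pair18_strips_of_elem hElem) (nsmul_mem K12c_split 2))
    (nsmul_mem Smr_rel 2)) (nsmul_mem Kh_split 2)) (nsmul_mem Shmr_rel 2)

end G8

/-! ## §5 The inversion junk `[E0] + [Ax1] − [U1] ≡ ¼·log²2` by moves (moving cut + symmetry + tensor square)

`Θ(0,m) = ∫₀¹ log(1+mx²) dx/x = ∫₀^m log(1+μ)/(2μ) dμ`; `[Ax1] = Θ(0,2)`, `[E0] = Θ(0,½)`, `[U1] = 2Θ(0,1)`, so the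
bracket is `∫₁² F − ∫_{½}^{1} F` with `F(μ) = log(1+μ)/(2μ)`.  After `x ↦ x²` (`rel_sq`) and `μ ↦ 1/μ` on the second
piece (Möbius-reflect of the parameter, `rel_moeb1` + `rel_reflect`), both pieces live over `m = 1 + t ∈ [1,2]` with fibres
`∫₁^{1+m} dw/(2mw)` and `∫_m^{1+m} dw/(2mw)`; their difference is the TRIANGLE `{1 ≤ w ≤ m ≤ 2}` of the symmetric form
`dw dm/(2mw)` (domain additivity with the MOVING cut `w = m`), i.e. half the square `[1,2]²`, i.e. `¼ log²2`
(swap symmetry + additivity + tensor square `[□², 1/((1+x)(1+y))] = log²2`).  All sets are polygons in the master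
coordinates `(w̃, t)`, `w = 1 + 2w̃`, `m = 1 + t`, cut out of the square by the lines `2w̃ = t`, `2w̃ = 1 + t`, `2w̃ = 1`. -/

section Inv0

/-- the Möbius datum in the second coordinate -/
def Mob1 : RFun 2 := ⟨C 2 * X 1, C 1 + X 1, fun x hx => by
  have h0 := (hx 1).1
  simp only [map_add, map_sub, map_mul, map_pow, map_neg, aeval_C, aeval_X, map_one, map_ofNat,
      eq_ratCast, Rat.cast_one, Rat.cast_ofNat, Rat.cast_div, Rat.cast_neg, Rat.cast_zero]
  positivity⟩

end Inv0
end Summit.KontsevichZagierPeriods.RootDecompQuadraticDescent.Pair18Homotopy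
end
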